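import Mathlib

/-!
# Markman 2025 — the equivariance paragraph of §9.3 (v2 p. 81 L66 – p. 82 L12): «The image of the obstruction map
# `ob_{E′} : HT²(X × X) → Ext²(E′, E′)` is `Ext²(E′, E′)^{G₁×G₂}`» — BOTH printed inclusions as linear algebra, in
# particular the REVERSE inclusion via the invariants of a tensor product, AS PRINTED, kernel-checked

E. Markman: [M] *Cycles on abelian 2n-folds of Weil type from secant sheaves on abelian n-folds*,
arXiv:2502.03415 **v2** (2025-06-08), bib `Markman2025SecantWeil` — UNREFEREED PREPRINT. «p. N L m» = PyMuPDF line `m`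
of page `N` of the public v2 PDF (sha256/16 `8155aa33870069b8`), text layer re-extracted at seat lit-w-markman g21
(pub-hsemireg LIT-W, 2026-08-25; sheet `LOCATOR-SHEET-MARKMAN.md` §2 carries §9.3 verbatim, §66 this file; the paragraph
and its one display — p. 81 L69, the map `ob_{E′}` — were also read by eye on the renders `r_mar25v2_p81_bottom.png`,
`r_mar25v2_p82_top.png` in `HOME/lit/Markman-renders-litw-markman-g21/`). `EquivariantSemiregularityDescent.lean` §A0 (LEAN #32 of the lineage) has
the FIRST inclusion in a `Γ`-set model and takes the reverse one BY VALUE; this leaf gives the linear-algebra mechanism of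
the reverse inclusion — the one step of LEMMA 9.3.2 («The image of the obstruction homomorphism `ob_𝒢 …` is
`Hom(𝒢, 𝒢[2])^G`», p. 82 L24–25, calligraphic `𝒢` the object, italic `G` the group; proof L26–27: «The statement follows from the equality, observed above, of the image of `ob_{E′}` and
`Hom((E′, λ′), (E′, λ′)[2])^{G₁×G₂}`») that was not yet kernel-checked (rows M-Mk6 ∕ W1 of the LIT-W table).

## What is printed (verbatim, v2 p. 81 L66 – p. 82 L12)

«Set `E′ := I_{∪_{i=1}^n Σ_i} ⊠ I_{∪_{i=1}^n C_i}`. The image of the obstruction map `ob_{E′} : HT²(X × X) → Ext²(E′, E′)`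
is `Ext²(E′, E′)^{G₁×G₂}`. The inclusion `Im(ob_{E′}) ⊂ Ext²(E′, E′)^{G₁×G₂}` follows from the `G_i`-equivariance of
`ob_{I_{∪C_i}}` and `ob_{I_{∪Σ_i}}` and the fact that both groups act trivially on `HT²(X × X)`. The inclusion
`Ext²(E′, E′)^{G₁×G₂} ⊂ Im(ob_{E′})` follows from the surjectivity of `HT^j(X) → Ext^j(I_{∪C_i}, I_{∪C_i})^{G₁}`, for
`j ≤ 2`, and the analogous surjectivity for `I_{∪Σ_i}`, which in turn follows from Lemmas 8.3.7 and 8.3.8.»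
Context: `G₁, G₂ ⊂ Pic⁰(C) ≅ X` finite subgroups of order `n = d + 1` (p. 81 L24–27, Lemma 9.3.1), acting on `X × X`
factorwise by translations; ground field `ℂ`.

## The model and what is proved (0 `def`, 0 named fact, 0 sorry; nothing geometric)

`k` a commutative ring (`ℂ`); `G`, `H` groups (`G₂`, `G₁` — the two factors); `ρ : Representation k G V`,
`σ : Representation k H W` (`V = ⊕_j Ext^j(I_{∪Σ_i}, I_{∪Σ_i})`, `W = ⊕_j Ext^j(I_{∪C_i}, I_{∪C_i})`, or one Künneth
summand each); `G × H` acts on `V ⊗_k W` by `(g, h) ↦ ρ(g) ⊗ σ(h)` — the invariance condition is written out as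
`∀ g h, TensorProduct.map (ρ g) (σ h) x = x` and identified with Mathlib's `Representation.invariants` of
`(ρ ∘ pr₁) ⊗ (σ ∘ pr₂)` (`mem_invariants_tprod_iff`). The Künneth decomposition
`Ext²(E′, E′) = ⊕_{i+j=2} Ext^i ⊗ Ext^j`, `HT²(X × X) = ⊕ HT^i(X) ⊗ HT^j(X)` and the compatibility
`ob_{A ⊠ B} = ⊕ ob_A ⊗ ob_B` are BY VALUE; §C records the trivial assembly over finitely many summands.
* §A (FIRST inclusion, linear form of LEAN #32 §A0): a linear map `ob : T → V` that is `G`-EQUIVARIANT for the TRIVIAL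
  action on `T` (`ρ g ∘ ob = ob`) has `range ob ≤ invariants` (`range_le_invariants_of_trivial_source`); tensor level:
  pure tensors of invariants, hence the whole image of `V^G ⊗ W^H → V ⊗ W`, are `G × H`-invariant
  (`tmul_invariant`, `range_mapIncl_le_invariants` — any commutative ring, any groups).
* §B (the REVERSE inclusion's mechanism): for FINITE `G`, `H` whose orders are invertible in `k` (here `|G_i| = d + 1`,
  `k = ℂ`), every `G × H`-invariant tensor lies in the image of `V^G ⊗ W^H` (`invariant_mem_range_mapIncl`), so
  `(V ⊗ W)^{G×H} = im(V^G ⊗ W^H → V ⊗ W)` (`invariants_tprod_eq_range_mapIncl`). Proof as one does it by hand: the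
  Reynolds operators `P = |G|⁻¹ Σ_g ρ(g)`, `Q = |H|⁻¹ Σ_h σ(h)` (written out, no definition introduced) land in the
  invariants and fix them (`reynolds_mem_invariants`, `reynolds_apply_of_mem`), `P ⊗ 1` fixes every `G × 1`-invariant
  tensor (`map_reynolds_id_apply`), hence an invariant `x` equals `(P ⊗ Q)x`, which visibly lies in the image.
* §B′ (the printed sentence): if `φ : T₁ → V` has `V^G ⊂ range φ` («surjectivity of `HT^j(X) → Ext^j(…)^{G₁}`») and
  `ψ : T₂ → W` has `W^H ⊂ range ψ`, then EVERY `G × H`-invariant of `V ⊗ W` lies in `range(φ ⊗ ψ)`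
  (`invariants_le_range_map` — «The inclusion `Ext²(E′, E′)^{G₁×G₂} ⊂ Im(ob_{E′})` follows from the surjectivity …»);
  with §A, if moreover `φ`, `ψ` are equivariant from trivial sources, `range(φ ⊗ ψ)` IS the invariant submodule
  (`range_map_eq_invariants`).
* §C (assembly over the Künneth summands, by value otherwise): componentwise statements give the statement for a finite
  product of components (`pi_mem_range_of_components`).
Honest framing: bookkeeping of a printed elementary step for seats re-deriving Markman's `G`-equivariant obstruction
image (Lemma 9.3.2 feeds Lemma 9.3.11 = `EquivariantSemiregularityDescent`); nothing here says that any object of the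
pub-hsemireg cell is semiregular, or that HC ∕ HC_CM ∕ HC_AV is proved; Lemmas 8.3.7 ∕ 8.3.8 (the surjectivities) are
BY VALUE and no theorem of [M] is re-proved beyond this linear algebra.
-/

namespace Literature.AlgebraicGeometry.Markman2025.ObstructionImageInvariants

open TensorProduct

variable {k : Type*} [CommRing k] {G H : Type*} [Group G] [Group H]
variable {V W : Type*} [AddCommGroup V] [Module k V] [AddCommGroup W] [Module k W]
variable (ρ : Representation k G V) (σ : Representation k H W)

/-! ### §A — the first inclusion: `Im(ob) ⊂` invariants; invariants ⊗ invariants are invariant -/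

/-- «The inclusion `Im(ob_{E′}) ⊂ Ext²(E′, E′)^{G₁×G₂}` follows from the `G_i`-equivariance of `ob_{I_{∪C_i}}` and
`ob_{I_{∪Σ_i}}` and the fact that both groups act trivially on `HT²(X × X)`» — linear form: a linear map `ob : T → V`
with `ρ(g) ∘ ob = ob` for all `g` (equivariance for the TRIVIAL action on `T`) has image inside `V^G`.
[cite: Markman2025SecantWeil, §9.3, v2 p. 82 L3–7] -/
theorem range_le_invariants_of_trivial_source {T : Type*} [AddCommGroup T] [Module k T] (ob : T →ₗ[k] V)
    (hob : ∀ g, ρ g ∘ₗ ob = ob) : LinearMap.range ob ≤ ρ.invariants := by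
  rintro v ⟨t, rfl⟩ g
  exact LinearMap.congr_fun (hob g) t

/-- A pure tensor of invariants is `G × H`-invariant: `(ρ(g) ⊗ σ(h))(v ⊗ w) = v ⊗ w` for `v ∈ V^G`, `w ∈ W^H`.
[cite: Markman2025SecantWeil, §9.3, v2 p. 82 L3–7 (first inclusion, tensor form)] -/
theorem tmul_invariant {v : V} {w : W} (hv : v ∈ ρ.invariants) (hw : w ∈ σ.invariants) (g : G) (h : H) :
    TensorProduct.map (ρ g) (σ h) (v ⊗ₜ[k] w) = v ⊗ₜ[k] w := by
  rw [TensorProduct.map_tmul, hv g, hw h]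

/-- Hence the whole image of `V^G ⊗ W^H → V ⊗ W` consists of `G × H`-invariants (any commutative ring, any groups).
[cite: Markman2025SecantWeil, §9.3, v2 p. 82 L3–7 (first inclusion, tensor form)] -/
theorem range_mapIncl_le_invariants (x : V ⊗[k] W)
    (hx : x ∈ LinearMap.range (TensorProduct.mapIncl ρ.invariants σ.invariants)) (g : G) (h : H) :
    TensorProduct.map (ρ g) (σ h) x = x := by
  obtain ⟨y, rfl⟩ := hx
  rw [← LinearMap.comp_apply, TensorProduct.mapIncl, ← TensorProduct.map_comp]
  congr 1
  refine TensorProduct.ext' fun v w => ?_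
  simp only [TensorProduct.map_tmul, LinearMap.comp_apply, Submodule.subtype_apply]
  rw [v.2 g, w.2 h]

/-! ### §B — the reverse inclusion: invariants of `V ⊗ W` come from `V^G ⊗ W^H` (finite groups of invertible order) -/

section Reynolds

variable [Fintype G] [Invertible (Fintype.card G : k)]

/-- The Reynolds operator `P = |G|⁻¹ Σ_g ρ(g)` lands in the invariants (cf. Mathlib `Representation.averageMap_invariant`;
written out here so that `P ⊗ 1` can be computed on tensors). [cite: Markman2025SecantWeil, §9.3, v2 p. 82 L7–12 (mechanism of the reverse inclusion)] -/
theorem reynolds_mem_invariants (v : V) : (⅟(Fintype.card G : k) • ∑ g : G, ρ g) v ∈ ρ.invariants := by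
  intro g₀
  rw [LinearMap.smul_apply, LinearMap.sum_apply, map_smul, map_sum]
  congr 1
  simp_rw [← Module.End.mul_apply, ← map_mul]
  exact Fintype.sum_equiv (Equiv.mulLeft g₀) _ _ fun g => rfl

/-- … and fixes the invariants: `P v = v` for `v ∈ V^G` (cf. Mathlib `Representation.averageMap_id`).
[cite: Markman2025SecantWeil, §9.3, v2 p. 82 L7–12 (mechanism of the reverse inclusion)] -/
theorem reynolds_apply_of_mem {v : V} (hv : v ∈ ρ.invariants) : (⅟(Fintype.card G : k) • ∑ g : G, ρ g) v = v := by
  rw [LinearMap.smul_apply, LinearMap.sum_apply]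
  simp_rw [hv _]
  rw [Finset.sum_const, Finset.card_univ, ← Nat.cast_smul_eq_nsmul k, smul_smul, invOf_mul_self, one_smul]

/-- `P ⊗ 1` on tensors: `(P ⊗ 1)x = |G|⁻¹ Σ_g (ρ(g) ⊗ 1)x` for every tensor `x` (linearity of `⊗` in the first map).
[cite: Markman2025SecantWeil, §9.3, v2 p. 82 L7–12 (mechanism of the reverse inclusion)] -/
theorem map_reynolds_id (x : V ⊗[k] W) :
    TensorProduct.map (⅟(Fintype.card G : k) • ∑ g : G, ρ g) (LinearMap.id : W →ₗ[k] W) x =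
      ⅟(Fintype.card G : k) • ∑ g : G, TensorProduct.map (ρ g) LinearMap.id x := by
  induction x using TensorProduct.induction_on with
  | zero => simp
  | tmul v w =>
      simp only [TensorProduct.map_tmul, LinearMap.smul_apply, LinearMap.sum_apply, LinearMap.id_apply,
        TensorProduct.sum_tmul, ← TensorProduct.smul_tmul']
  | add x y hx hy => simp only [map_add, hx, hy, Finset.sum_add_distrib, smul_add]

/-- Hence `(P ⊗ 1)x = x` for every tensor `x` fixed by all `ρ(g) ⊗ 1`.
[cite: Markman2025SecantWeil, §9.3, v2 p. 82 L7–12 (mechanism of the reverse inclusion)] -/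
theorem map_reynolds_id_apply {x : V ⊗[k] W} (hx : ∀ g : G, TensorProduct.map (ρ g) LinearMap.id x = x) :
    TensorProduct.map (⅟(Fintype.card G : k) • ∑ g : G, ρ g) (LinearMap.id : W →ₗ[k] W) x = x := by
  rw [map_reynolds_id]
  simp_rw [hx _]
  rw [Finset.sum_const, Finset.card_univ, ← Nat.cast_smul_eq_nsmul k, smul_smul, invOf_mul_self, one_smul]

end Reynolds

section ReynoldsRight

variable [Fintype H] [Invertible (Fintype.card H : k)]

/-- The mirror statement for `1 ⊗ Q`, `Q = |H|⁻¹ Σ_h σ(h)`: `(1 ⊗ Q)x = x` for every tensor fixed by all `1 ⊗ σ(h)`.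
[cite: Markman2025SecantWeil, §9.3, v2 p. 82 L7–12 (mechanism of the reverse inclusion)] -/
theorem map_id_reynolds_apply {x : V ⊗[k] W} (hx : ∀ h : H, TensorProduct.map LinearMap.id (σ h) x = x) :
    TensorProduct.map (LinearMap.id : V →ₗ[k] V) (⅟(Fintype.card H : k) • ∑ h : H, σ h) x = x := by
  -- transport the left statement through the symmetry `V ⊗ W ≅ W ⊗ V`
  have key : ∀ y : W ⊗[k] V, (∀ h : H, TensorProduct.map (σ h) LinearMap.id y = y) →
      TensorProduct.map (⅟(Fintype.card H : k) • ∑ h : H, σ h) (LinearMap.id : V →ₗ[k] V) y = y :=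
    fun y hy => map_reynolds_id_apply σ hy
  have hcomm : ∀ (f : W →ₗ[k] W) (y : V ⊗[k] W),
      TensorProduct.map LinearMap.id f y = TensorProduct.comm k W V (TensorProduct.map f LinearMap.id
        (TensorProduct.comm k V W y)) := by
    intro f y
    induction y using TensorProduct.induction_on with
    | zero => simp
    | tmul v w => simp
    | add a b ha hb => simp only [map_add, ha, hb]
  rw [hcomm, key _ fun h => ?_, TensorProduct.comm_comm]
  have h1 := hx h
  rw [hcomm] at h1
  have h2 := congrArg (TensorProduct.comm k V W) h1
  rwa [TensorProduct.comm_comm] at h2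

end ReynoldsRight

section Both

variable [Fintype G] [Invertible (Fintype.card G : k)] [Fintype H] [Invertible (Fintype.card H : k)]

/-- **The reverse inclusion's mechanism**: for finite `G`, `H` of orders invertible in `k`, every `G × H`-invariant
tensor lies in the image of `V^G ⊗ W^H → V ⊗ W` — it equals `(P ⊗ Q)x` and `P`, `Q` land in the invariants.
[cite: Markman2025SecantWeil, §9.3, v2 p. 82 L7–12 (the inclusion `Ext²(E′,E′)^{G₁×G₂} ⊂ Im(ob_{E′})`, mechanism)] -/
theorem invariant_mem_range_mapIncl (x : V ⊗[k] W) (hx : ∀ (g : G) (h : H), TensorProduct.map (ρ g) (σ h) x = x) :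
    x ∈ LinearMap.range (TensorProduct.mapIncl ρ.invariants σ.invariants) := by
  set P : V →ₗ[k] V := ⅟(Fintype.card G : k) • ∑ g : G, ρ g with hP
  set Q : W →ₗ[k] W := ⅟(Fintype.card H : k) • ∑ h : H, σ h with hQ
  have hxG : ∀ g : G, TensorProduct.map (ρ g) LinearMap.id x = x := fun g => by
    have e := hx g 1
    rwa [map_one, Module.End.one_eq_id] at e
  have hxH : ∀ h : H, TensorProduct.map LinearMap.id (σ h) x = x := fun h => by
    have e := hx 1 h
    rwa [map_one, Module.End.one_eq_id] at e
  have h1 : TensorProduct.map P LinearMap.id x = x := map_reynolds_id_apply ρ hxG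
  have h2 : TensorProduct.map LinearMap.id Q x = x := map_id_reynolds_apply σ hxH
  have h3 : TensorProduct.map P Q x = x := by
    conv_rhs => rw [← h1, ← h2]
    rw [← LinearMap.comp_apply, ← TensorProduct.map_comp, LinearMap.comp_id, LinearMap.id_comp]
  -- `P = ι_V ∘ P'`, `Q = ι_W ∘ Q'` with `P'`, `Q'` the corestrictions to the invariants
  let P' : V →ₗ[k] ρ.invariants := LinearMap.codRestrict ρ.invariants P (reynolds_mem_invariants ρ)
  let Q' : W →ₗ[k] σ.invariants := LinearMap.codRestrict σ.invariants Q (reynolds_mem_invariants σ)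
  have hPQ : TensorProduct.map P Q =
      TensorProduct.mapIncl ρ.invariants σ.invariants ∘ₗ TensorProduct.map P' Q' := by
    rw [TensorProduct.mapIncl, ← TensorProduct.map_comp]
    rfl
  rw [← h3, hPQ]
  exact LinearMap.mem_range_self _ _

/-- `(V ⊗ W)^{G×H} = im(V^G ⊗ W^H → V ⊗ W)`, both inclusions (§A + §B), as an equality of SETS of tensors.
[cite: Markman2025SecantWeil, §9.3, v2 p. 81 L66 – p. 82 L12] -/
theorem invariants_tprod_eq_range_mapIncl :
    {x : V ⊗[k] W | ∀ (g : G) (h : H), TensorProduct.map (ρ g) (σ h) x = x} =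
      (LinearMap.range (TensorProduct.mapIncl ρ.invariants σ.invariants) : Set (V ⊗[k] W)) := by
  ext x
  exact ⟨fun hx => invariant_mem_range_mapIncl ρ σ x hx,
    fun hx g h => range_mapIncl_le_invariants ρ σ x hx g h⟩

/-- The same in Mathlib's vocabulary: the invariants of the product representation `(g, h) ↦ ρ(g) ⊗ σ(h)` of `G × H`
(`Representation.tprod` of the two pull-backs) are exactly the image of `V^G ⊗ W^H`.
[cite: Markman2025SecantWeil, §9.3, v2 p. 81 L66 – p. 82 L12] -/
theorem invariants_tprod_eq :
    (Representation.tprod (ρ.comp (MonoidHom.fst G H)) (σ.comp (MonoidHom.snd G H)) :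
        Representation k (G × H) (V ⊗[k] W)).invariants =
      LinearMap.range (TensorProduct.mapIncl ρ.invariants σ.invariants) := by
  ext x
  rw [Representation.mem_invariants]
  constructor
  · intro hx
    refine invariant_mem_range_mapIncl ρ σ x fun g h => ?_
    simpa [Representation.tprod_apply] using hx (g, h)
  · intro hx gh
    simpa [Representation.tprod_apply] using range_mapIncl_le_invariants ρ σ x hx gh.1 gh.2

/-! ### §B′ — the printed sentence: surjectivity onto the invariants on each factor ⟹ onto the invariants of `⊗` -/

/-- «The inclusion `Ext²(E′, E′)^{G₁×G₂} ⊂ Im(ob_{E′})` follows from the surjectivity of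
`HT^j(X) → Ext^j(I_{∪C_i}, I_{∪C_i})^{G₁}`, for `j ≤ 2`, and the analogous surjectivity for `I_{∪Σ_i}`» — if `V^G ⊂ range φ`
and `W^H ⊂ range ψ`, then every `G × H`-invariant tensor of `V ⊗ W` lies in `range(φ ⊗ ψ)` (finite groups of orders
invertible in `k`; `ob_{A⊠B} = Σ ob_A ⊗ ob_B` on Künneth summands BY VALUE).
[cite: Markman2025SecantWeil, §9.3, v2 p. 82 L7–12] -/
theorem invariants_le_range_map {T₁ T₂ : Type*} [AddCommGroup T₁] [Module k T₁] [AddCommGroup T₂] [Module k T₂]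
    (φ : T₁ →ₗ[k] V) (ψ : T₂ →ₗ[k] W) (hφ : ρ.invariants ≤ LinearMap.range φ) (hψ : σ.invariants ≤ LinearMap.range ψ)
    (x : V ⊗[k] W) (hx : ∀ (g : G) (h : H), TensorProduct.map (ρ g) (σ h) x = x) :
    x ∈ LinearMap.range (TensorProduct.map φ ψ) := by
  have hx' := invariant_mem_range_mapIncl ρ σ x hx
  rw [TensorProduct.range_mapIncl] at hx'
  refine (Submodule.map₂_le.mpr ?_) hx'
  intro v hv w hw
  obtain ⟨t, rfl⟩ := hφ hv
  obtain ⟨s, rfl⟩ := hψ hw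
  exact ⟨t ⊗ₜ s, by simp⟩

/-- Both inclusions together: if `φ : T₁ → V`, `ψ : T₂ → W` are equivariant for the trivial actions on the sources
(«both groups act trivially on `HT²`») and surject onto the invariants, then `range(φ ⊗ ψ)` IS the set of
`G × H`-invariants of `V ⊗ W` — «The image of the obstruction map `ob_{E′}` … is `Ext²(E′, E′)^{G₁×G₂}`» on each Künneth
summand. [cite: Markman2025SecantWeil, §9.3, v2 p. 81 L66 – p. 82 L12] -/
theorem range_map_eq_invariants {T₁ T₂ : Type*} [AddCommGroup T₁] [Module k T₁] [AddCommGroup T₂] [Module k T₂]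
    (φ : T₁ →ₗ[k] V) (ψ : T₂ →ₗ[k] W) (hφG : ∀ g, ρ g ∘ₗ φ = φ) (hψH : ∀ h, σ h ∘ₗ ψ = ψ)
    (hφ : ρ.invariants ≤ LinearMap.range φ) (hψ : σ.invariants ≤ LinearMap.range ψ) :
    (LinearMap.range (TensorProduct.map φ ψ) : Set (V ⊗[k] W)) =
      {x : V ⊗[k] W | ∀ (g : G) (h : H), TensorProduct.map (ρ g) (σ h) x = x} := by
  ext x
  refine ⟨?_, fun hx => invariants_le_range_map ρ σ φ ψ hφ hψ x hx⟩
  rintro ⟨y, rfl⟩ g h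
  rw [← LinearMap.comp_apply, ← TensorProduct.map_comp, hφG g, hψH h]

end Both

/-! ### §C — assembly over the (finitely many) Künneth summands, the decomposition itself BY VALUE -/

/-- If on every summand `i` the given subset `S_i` (the invariants) lies in the range of `f_i`, then every family
`x = (x_i)` with `x_i ∈ S_i` lies in the range of the product map `(t_i) ↦ (f_i t_i)` — the step from
«for `j ≤ 2`» summand by summand to `Ext²(E′, E′) = ⊕_{i+j=2} Ext^i ⊗ Ext^j`.
[cite: Markman2025SecantWeil, §9.3, v2 p. 82 L7–12 («for `j ≤ 2`», assembly)] -/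
theorem pi_mem_range_of_components {ι : Type*} {T U : ι → Type*} [∀ i, AddCommGroup (T i)] [∀ i, Module k (T i)]
    [∀ i, AddCommGroup (U i)] [∀ i, Module k (U i)] (f : ∀ i, T i →ₗ[k] U i) (S : ∀ i, Set (U i))
    (hS : ∀ i, S i ⊆ LinearMap.range (f i)) (x : ∀ i, U i) (hx : ∀ i, x i ∈ S i) :
    x ∈ LinearMap.range (LinearMap.pi fun i => f i ∘ₗ LinearMap.proj i : (∀ i, T i) →ₗ[k] ∀ i, U i) := by
  choose t ht using fun i => hS i (hx i)
  exact ⟨t, funext fun i => by simpa using ht i⟩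

end Literature.AlgebraicGeometry.Markman2025.ObstructionImageInvariants
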